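import Literature.MathematicalPhysics.KineticTheory.CollisionTubeFunctional
import HarnessLib

/-!
# The even (momentum-transfer) collision statistic, the Enskog rate functional and the even tube
# functional

Topic `Literature/MathematicalPhysics/KineticTheory` — companion of `CollisionTubeFunctional.lean`
(the vocabulary of the crux line `equilibrium-rung-mean-variance` of `JParityClosure.OddContactSymmetry`,
stmt-AtomisticToContinuum-13078).  This file is the tree home of the vocabulary of the TRANSPLANTED line
`even-rung-mean-variance` of the configurational crux `JParityClosure.EvenStressEnskog`
(stmt-AtomisticToContinuum-13079): the same chassis (collision sum · velocity truncation · fixed-time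
collision tube · time integration) with the J-odd bounded mark replaced by the J-EVEN, velocity-UNBOUNDED
collisional momentum-transfer marks `Ξ_P^{kl}(n, v, w) = ((w − v)·n)₊ n_k n_l` (Chapman–Cowling Ch. 16:
the collisional transfer of momentum of the dense hard-sphere gas; Enskog's prediction multiplies the
Stosszahlansatz rate by the contact value `Y` of the pair correlation), and with the Enskog PREDICTION
`σ³ ∫₀^τ ∫ χ g(σ³ρ_r) Y(σ³ρ_r) B_r dx ds` as the subtracted term, `Y(η) = (3/2π)·f_ex′(η)` the
thermodynamic contact value of `HardSphereEuler.lean` (`hsExcessFreeEnergy`; `Z = 1 + η f_ex′ =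
1 + (2π/3) η Y`, the virial / contact theorem).  All bodies are copied verbatim from the line's checked
skeleton (they are the `let`-chain of the route declaration `EvenStressEnskog` for one `N`, one flow and
one mark), so that its registered stubs can be stated from `Theorems/` files (a `Lines/` file is never
imported).

* `evenMark k l` — `Ξ_P^{kl}`; `evenMarkTrunc k l L` — its continuous truncation at relative speed `L`
  (`= Ξ_P^{kl}` at unit normal and `‖w − v‖ ≤ L`, `= 0` for `‖w − v‖ ≥ 2L`, `|·| ≤ 2L`), built from the
  coordinate clip `clip1` and the speed cutoff `speedCutoff` (API below, all proved).
* `coneKernel r`, `mollDensity r z x₀`, `sphereMark Ξ v w`, `pairFunctional r Ξ z x₀`, `contactValue` —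
  the cone mollifier `b_r`, the `r`-mollified empirical density `ρ_r`, the sphere-integrated mark
  `Θ Ξ v w = ∫ Ξ(ω,v,w)((w−v)·ω)₊ dω`, the pair functional `B_r Ξ = ∫∫ b_r b_r Θ dμ_z dμ_z` and
  `Y = (3/2π)·deriv hsExcessFreeEnergy` (junk `0` at `0`, where `f_ex` is not differentiable; the
  physical `Y(0⁺) = 1` is only ever read through the analytic equation of state on the open low-density
  band).
* `enskogRate σ N χ g Ξ r t z = ∫_{𝕋³} χ(t,x) g(σ³ρ_r(z,x)) Y(σ³ρ_r(z,x)) B_r Ξ (z,x) dx` — the Enskog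
  rate functional of ONE configuration (so that the crux's Enskog term is `σ³ ∫₀^τ e_s(Φ_s z) ds`).
* `collisionSum σ N Φ τ χ g Ξ r z` — the unweighted collision sum `K_N[χ g Ξ]` (the crux's `Kc` applied
  to its mark; it is `oddStatTrunc … r ϑ 1` of `CollisionTubeFunctional`, the reweighting
  `min(1 + e^{−F}, 1) = 1` being inert: `oddStatTrunc_one_eq_collisionSum`).
* `evenStat … = collisionSum … − σ³ ∫_{s ∈ [0,τ]} enskogRate … s (Φ.flow s z)` — the crux statistic.
* `evenTubeStat σ N χ g Ξ r κ t z = tubeStat σ N χ g Ξ r r 1 κ t z − σ³ · enskogRate σ N χ g Ξ r t z` —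
  the fixed-time even tube functional `W_t = A_t − σ³ e_t` (the tree's tube functional at truncation
  level `1`, velocity-mollification scale a dummy `ϑ := r`), and
  `evenTubeTimeStat … = ∫_{t ∈ [0,τ]} evenTubeStat … t (Φ.flow t z)`.

## References

* S. Chapman, T. G. Cowling, *The Mathematical Theory of Non-Uniform Gases*, 3rd ed. (1970), Ch. 16
  (Enskog's dense-gas theory: collisional transfer of molecular properties, the factor `χ = Y` at
  contact).  [ChapmanCowling1970]
* H. van Beijeren, M. H. Ernst, Physica 68 (1973) 437–456 (modified Enskog equation; the contact value
  as the local-equilibrium pair correlation at contact).  [VanbeijerenErnst1973]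
* P. Résibois, J. Stat. Phys. 19 (1978) 593–609 (H-theorem for the modified Enskog equation).
  [Resibois1978]
* C. Cercignani, R. Illner, M. Pulvirenti, *The Mathematical Theory of Dilute Gases* (1994), §2.2
  (collision cylinders).  [CIPDiluteGases1994]
* H. Spohn, *Large Scale Dynamics of Interacting Particles* (1991), Part I Ch. 3.  [Spohn1991]

## Not here

No measurability, integrability or limit statement: the line's six stubs (velocity truncation,
cylinder pull-back, mean = Enskog, fixed-time variance, `L² →` probability, regularity) and their
composition are problem-side statements (`Summits/AtomisticToContinuum/HydrodynamicLimit/…`).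
-/

noncomputable section

open scoped BigOperators Classical InnerProductSpace ENNReal
open Set MeasureTheory
open Literature.Analysis.FluidPDE

namespace Literature.MathematicalPhysics.KineticTheory

/-! ## The even marks and their truncation -/

/-- The J-even collisional momentum-transfer mark `Ξ_P^{kl}(n, v, w) = ((w − v)·n)₊ n_k n_l`
(Chapman–Cowling Ch. 16; verbatim the `ΞP` of the route declaration `EvenStressEnskog`; unbounded in
the velocities). [cite: ChapmanCowling1970, Ch. 16] -/
def evenMark (k l : Fin 3) (q : V3 × V3 × V3) : ℝ :=
  max ⟪q.2.2 - q.2.1, q.1⟫_ℝ 0 * (q.1 k * q.1 l)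

/-- Coordinate clip to `[-1, 1]` (invisible on the coordinates of a unit vector). [folklore] -/
def clip1 (x : ℝ) : ℝ := max (min x 1) (-1)

/-- Continuous relative-speed cutoff `ψ_L(s) = (min(2 − s/L, 1))₊`: `= 1` for `s ≤ L`, `= 0` for
`s ≥ 2L` (`0 < L`). [folklore] -/
def speedCutoff (L s : ℝ) : ℝ := max (min (2 - s / L) 1) 0

/-- The TRUNCATED even mark `Ξ_L^{kl}(n, v, w) = min(((w−v)·n)₊, 2L) · clip(n_k) clip(n_l) · ψ_L(‖w−v‖)`:
continuous, bounded by `2L`, vanishing for `‖w − v‖ ≥ 2L`, and equal to `Ξ_P^{kl}` whenever `‖n‖ = 1`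
and `‖w − v‖ ≤ L` (at every genuine collision / tube pair of relative speed `≤ L`). [folklore] -/
def evenMarkTrunc (k l : Fin 3) (L : ℝ) (q : V3 × V3 × V3) : ℝ :=
  min (max ⟪q.2.2 - q.2.1, q.1⟫_ℝ 0) (2 * L) * (clip1 (q.1 k) * clip1 (q.1 l)) * speedCutoff L ‖q.2.2 - q.2.1‖

/-! ## Mollified fields, the pair functional, the contact value, the Enskog rate -/

/-- The normalised cone mollifier `b_r(x, y) = 3/(πr³)·(1 − dist(x,y)/r)₊` on `𝕋³` (verbatim the `bx`
of the route declarations `OddContactSymmetry` / `EvenStressEnskog`; total mass `1` for `r < 1/2`).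
[folklore] -/
def coneKernel (r : ℝ) (x y : UnitAddTorus (Fin 3)) : ℝ :=
  3 / (Real.pi * r ^ 3) * max (1 - Torus.euclidDist x y / r) 0

/-- The `r`-mollified empirical density `ρ_r(x₀) = ∫ b_r(x, x₀) dμ_z` of ONE configuration of `N + 1`
particles (verbatim the `ρm` of `EvenStressEnskog` at a fixed configuration). [folklore] -/
def mollDensity {N : ℕ} (r : ℝ) (z : Config (N + 1) (Fin 3) T3) (x₀ : UnitAddTorus (Fin 3)) : ℝ :=
  ∫ q, coneKernel r q.1 x₀ ∂(empiricalMeasure z)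

/-- The sphere-integrated mark `Θ Ξ v w = ∫_{S²} Ξ(ω, v, w) ((w − v)·ω)₊ dω` (verbatim the `Θ` of
`EvenStressEnskog`; `hardSphereKernel (w, v) ω = ((w − v)·ω)₊`). [folklore] -/
def sphereMark (Ξ : V3 × V3 × V3 → ℝ) (v w : V3) : ℝ :=
  ∫ ω : Metric.sphere (0 : V3) 1, Ξ ((ω : V3), v, w) * hardSphereKernel (w, v) ω ∂sphereMeasure

/-- The `r`-mollified pair functional `B_r Ξ (x₀) = ∫∫ b_r(x, x₀) b_r(x', x₀) Θ Ξ v v' dμ_z dμ_z` of ONE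
configuration (verbatim the `B` of `EvenStressEnskog` at a fixed configuration; the diagonal is included
and contributes `0` since `Θ Ξ v v = 0`). [folklore] -/
def pairFunctional {N : ℕ} (r : ℝ) (Ξ : V3 × V3 × V3 → ℝ) (z : Config (N + 1) (Fin 3) T3)
    (x₀ : UnitAddTorus (Fin 3)) : ℝ :=
  ∫ p, coneKernel r p.1.1 x₀ * coneKernel r p.2.1 x₀ * sphereMark Ξ p.1.2 p.2.2
    ∂((empiricalMeasure z).prod (empiricalMeasure z))

/-- The thermodynamic contact value `Y(a) = (3/2π)·f_ex′(a)` of the hard-sphere gas at reduced density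
`a` (verbatim the `Y` of `EvenStressEnskog`: `Z = 1 + a f_ex′(a) = 1 + (2π/3) a Y(a)`, virial / contact
theorem, Chapman–Cowling (16.31,4)); `deriv`-junk `0` wherever `hsExcessFreeEnergy` is not
differentiable, in particular AT `a = 0` (the physical right limit is `Y(0⁺) = 1`).
[cite: ChapmanCowling1970, Ch. 16] -/
def contactValue (a : ℝ) : ℝ := 3 / (2 * Real.pi) * deriv hsExcessFreeEnergy a

/-- **The fixed-time Enskog rate functional** `e_t(z) = ∫_{𝕋³} χ(t, x) g(σ³ρ_r(z, x)) Y(σ³ρ_r(z, x))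
B_r Ξ (z, x) dx` of ONE configuration `z` of `N + 1` spheres: Enskog's prediction, per unit time and per
`σ³`, for the collision sum of the mark `Ξ` weighted by `χ g(σ³ρ_r)`, read at time label `t` (only `χ`
depends on `t`), so that the Enskog term of `EvenStressEnskog` is `σ³ ∫₀^τ e_s(Φ_s z) ds` definitionally
(Bochner integral over `𝕋³`; junk `0` if not integrable). [cite: VanbeijerenErnst1973] -/
def enskogRate (σ : ℝ) (N : ℕ) (χ : ℝ × UnitAddTorus (Fin 3) → ℝ) (g : ℝ → ℝ) (Ξ : V3 × V3 × V3 → ℝ)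
    (r t : ℝ) (z : Config (N + 1) (Fin 3) T3) : ℝ :=
  ∫ x : UnitAddTorus (Fin 3), χ (t, x) * g (σ ^ 3 * mollDensity r z x) * contactValue (σ ^ 3 * mollDensity r z x) *
    pairFunctional r Ξ z x

/-! ## The collision sum and the crux statistic -/

/-- **The unweighted collision sum** `K_N[χ g Ξ](z) = ε/(N+1) Σ_{collision times s ≤ τ}
Σ_{ordered contact pairs (i,j)} χ(s, xᵢ) g(σ³ρ_r(xᵢ)) Ξ(ε⁻¹ sepVec xᵢ xⱼ, vᵢ⁻, vⱼ⁻)` along the trajectory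
`s ↦ Φ.flow s z` (verbatim the `Kc` of `EvenStressEnskog` applied to its mark; the pre-collisional
velocities are recovered from the right-continuous trajectory by the involution `reflectVel`; the
finsum is the junk `0` when infinitely many collision times lie in `[0, τ]`, excluded on the good set of
the flow).  It is `oddStatTrunc … r ϑ 1` (`oddStatTrunc_one_eq_collisionSum`). [folklore] -/
def collisionSum (σ : ℝ) (N : ℕ) (Φ : HardSphereFlow (Torus.geometry (Fin 3)) (hsDiameter σ N) (N + 1))
    (τ : ℝ) (χ : ℝ × UnitAddTorus (Fin 3) → ℝ) (g : ℝ → ℝ) (Ξ : V3 × V3 × V3 → ℝ) (r : ℝ)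
    (z : Config (N + 1) (Fin 3) T3) : ℝ :=
  let ε := hsDiameter σ N
  let G := Torus.geometry (Fin 3)
  let γ := fun z (s : ℝ) => Φ.flow s z
  ε / (N + 1 : ℝ) * ∑ᶠ (s : ℝ) (_ : s ∈ collisionTimes G ε (γ z) ∩ Set.Icc 0 τ),
    ∑ i : Fin (N + 1), ∑ j : Fin (N + 1),
      (if i ≠ j ∧ ‖G.sepVec (γ z s i).1 (γ z s j).1‖ = ε then
        χ (s, (γ z s i).1) * g (σ ^ 3 * mollDensity r (γ z s) (γ z s i).1) *
          Ξ (ε⁻¹ • G.sepVec (γ z s i).1 (γ z s j).1,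
            (reflectVel (G.sepVec (γ z s i).1 (γ z s j).1) ((γ z s i).2, (γ z s j).2)).1,
            (reflectVel (G.sepVec (γ z s i).1 (γ z s j).1) ((γ z s i).2, (γ z s j).2)).2)
      else 0)

/-- **The crux statistic** `D(z) = K_N[χ g Ξ](z) − σ³ ∫_{s ∈ [0,τ]} e_s(Φ_s z) ds` of `EvenStressEnskog`
for one `N`, one flow `Φ` and one mark `Ξ` (verbatim its `Dm Ξ z`, so that the crux reads
`… ∀ k l, localGibbsLaw … {z | η < |evenStat σ N (Φ N) τ χ g (evenMark k l) r z|} ≤ δ` by `Iff.rfl`).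
[folklore] -/
def evenStat (σ : ℝ) (N : ℕ) (Φ : HardSphereFlow (Torus.geometry (Fin 3)) (hsDiameter σ N) (N + 1))
    (τ : ℝ) (χ : ℝ × UnitAddTorus (Fin 3) → ℝ) (g : ℝ → ℝ) (Ξ : V3 × V3 × V3 → ℝ) (r : ℝ)
    (z : Config (N + 1) (Fin 3) T3) : ℝ :=
  collisionSum σ N Φ τ χ g Ξ r z - σ ^ 3 * ∫ s in Set.Icc (0 : ℝ) τ, enskogRate σ N χ g Ξ r s (Φ.flow s z)

/-! ## The even tube functional -/

/-- **The fixed-time even tube functional** `W_t(z) = A_t(z) − σ³ e_t(z)`: the collision-tube functional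
`tubeStat σ N χ g Ξ r ϑ L κ t z` of `CollisionTubeFunctional` at truncation level `L = 1` — where the
reweighting `min(1 + e^{−F̃}, 1) = 1` is INERT, so the velocity-mollification scale is a dummy, set to
`ϑ := r` — minus `σ³` times the Enskog rate functional of the SAME configuration.  A one-time object: no
path, no collision history. [folklore] -/
def evenTubeStat (σ : ℝ) (N : ℕ) (χ : ℝ × UnitAddTorus (Fin 3) → ℝ) (g : ℝ → ℝ) (Ξ : V3 × V3 × V3 → ℝ)
    (r κ t : ℝ) (z : Config (N + 1) (Fin 3) T3) : ℝ :=
  tubeStat σ N χ g Ξ r r 1 κ t z - σ ^ 3 * enskogRate σ N χ g Ξ r t z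

/-- **The time-integrated even tube statistic** `T_κ(z) = ∫_{t ∈ [0,τ]} W_t(Φ_t z) dt` along the
hard-sphere flow `Φ` started at `z` (Bochner integral over `Set.Icc 0 τ`; junk value `0` if the integrand
is not integrable). [folklore] -/
def evenTubeTimeStat (σ : ℝ) (N : ℕ) (Φ : HardSphereFlow (Torus.geometry (Fin 3)) (hsDiameter σ N) (N + 1))
    (τ : ℝ) (χ : ℝ × UnitAddTorus (Fin 3) → ℝ) (g : ℝ → ℝ) (Ξ : V3 × V3 × V3 → ℝ) (r κ : ℝ)
    (z : Config (N + 1) (Fin 3) T3) : ℝ :=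
  ∫ t in Set.Icc (0 : ℝ) τ, evenTubeStat σ N χ g Ξ r κ t (Φ.flow t z)

/-! ## API -/

/-- Unfolding of `evenStat` (definitional). [folklore] -/
theorem evenStat_def (σ : ℝ) (N : ℕ) (Φ : HardSphereFlow (Torus.geometry (Fin 3)) (hsDiameter σ N) (N + 1))
    (τ : ℝ) (χ : ℝ × UnitAddTorus (Fin 3) → ℝ) (g : ℝ → ℝ) (Ξ : V3 × V3 × V3 → ℝ) (r : ℝ)
    (z : Config (N + 1) (Fin 3) T3) :
    evenStat σ N Φ τ χ g Ξ r z =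
      collisionSum σ N Φ τ χ g Ξ r z - σ ^ 3 * ∫ s in Set.Icc (0 : ℝ) τ, enskogRate σ N χ g Ξ r s (Φ.flow s z) :=
  rfl

/-- Unfolding of `evenTubeStat` (definitional). [folklore] -/
theorem evenTubeStat_def (σ : ℝ) (N : ℕ) (χ : ℝ × UnitAddTorus (Fin 3) → ℝ) (g : ℝ → ℝ)
    (Ξ : V3 × V3 × V3 → ℝ) (r κ t : ℝ) (z : Config (N + 1) (Fin 3) T3) :
    evenTubeStat σ N χ g Ξ r κ t z = tubeStat σ N χ g Ξ r r 1 κ t z - σ ^ 3 * enskogRate σ N χ g Ξ r t z :=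
  rfl

/-- Unfolding of `evenTubeTimeStat` (definitional). [folklore] -/
theorem evenTubeTimeStat_def (σ : ℝ) (N : ℕ)
    (Φ : HardSphereFlow (Torus.geometry (Fin 3)) (hsDiameter σ N) (N + 1))
    (τ : ℝ) (χ : ℝ × UnitAddTorus (Fin 3) → ℝ) (g : ℝ → ℝ) (Ξ : V3 × V3 × V3 → ℝ) (r κ : ℝ)
    (z : Config (N + 1) (Fin 3) T3) :
    evenTubeTimeStat σ N Φ τ χ g Ξ r κ z =
      ∫ t in Set.Icc (0 : ℝ) τ, evenTubeStat σ N χ g Ξ r κ t (Φ.flow t z) :=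
  rfl

/-- **The reweighting is inert at truncation level `1`:** `oddStatTrunc … Ξ r ϑ 1 = collisionSum … Ξ r`
for every velocity-mollification scale `ϑ` (`min (1 + e^{−F}) 1 = 1`). [folklore] -/
theorem oddStatTrunc_one_eq_collisionSum (σ : ℝ) (N : ℕ)
    (Φ : HardSphereFlow (Torus.geometry (Fin 3)) (hsDiameter σ N) (N + 1))
    (τ : ℝ) (χ : ℝ × UnitAddTorus (Fin 3) → ℝ) (g : ℝ → ℝ) (Ξ : V3 × V3 × V3 → ℝ) (r ϑ : ℝ)
    (z : Config (N + 1) (Fin 3) T3) :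
    oddStatTrunc σ N Φ τ χ g Ξ r ϑ 1 z = collisionSum σ N Φ τ χ g Ξ r z := by
  have hmin : ∀ x : ℝ, min (1 + Real.exp x) 1 = 1 := fun x =>
    min_eq_right (le_add_of_nonneg_right (Real.exp_pos x).le)
  dsimp only [oddStatTrunc, collisionSum, mollDensity, coneKernel]
  simp only [hmin, mul_one]

/-- `|clip1 x| ≤ 1`. [folklore] -/
theorem abs_clip1_le (x : ℝ) : |clip1 x| ≤ 1 := by
  unfold clip1
  rw [abs_le]
  constructor
  · exact le_max_right _ _
  · exact max_le (min_le_right _ _) (by norm_num)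

/-- `clip1 x = x` for `|x| ≤ 1`. [folklore] -/
theorem clip1_eq_self {x : ℝ} (hx : |x| ≤ 1) : clip1 x = x := by
  unfold clip1
  rw [abs_le] at hx
  rw [min_eq_left hx.2, max_eq_left hx.1]

/-- `0 ≤ ψ_L ≤ 1`. [folklore] -/
theorem speedCutoff_mem_Icc (L s : ℝ) : speedCutoff L s ∈ Set.Icc (0 : ℝ) 1 :=
  ⟨le_max_right _ _, max_le (min_le_right _ _) zero_le_one⟩

/-- `ψ_L(s) = 1` for `s ≤ L` (`0 < L`). [folklore] -/
theorem speedCutoff_eq_one {L s : ℝ} (hL : 0 < L) (hs : s ≤ L) : speedCutoff L s = 1 := by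
  unfold speedCutoff
  have h1 : s / L ≤ 1 := (div_le_one hL).2 hs
  rw [min_eq_right (by linarith), max_eq_left zero_le_one]

/-- `ψ_L(s) = 0` for `2L ≤ s` (`0 < L`). [folklore] -/
theorem speedCutoff_eq_zero {L s : ℝ} (hL : 0 < L) (hs : 2 * L ≤ s) : speedCutoff L s = 0 := by
  unfold speedCutoff
  have h2 : 2 ≤ s / L := (le_div_iff₀ hL).2 (by linarith)
  rw [max_eq_right]
  exact (min_le_left _ _).trans (by linarith)

/-- **The truncated mark is continuous.** [folklore] -/
theorem continuous_evenMarkTrunc (k l : Fin 3) (L : ℝ) : Continuous (evenMarkTrunc k l L) := by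
  unfold evenMarkTrunc clip1 speedCutoff
  fun_prop

/-- **The truncated mark is bounded by `2L`** (`0 ≤ L`). [folklore] -/
theorem abs_evenMarkTrunc_le (k l : Fin 3) {L : ℝ} (hL : 0 ≤ L) (q : V3 × V3 × V3) :
    |evenMarkTrunc k l L q| ≤ 2 * L := by
  unfold evenMarkTrunc
  have hm0 : 0 ≤ min (max ⟪q.2.2 - q.2.1, q.1⟫_ℝ 0) (2 * L) := le_min (le_max_right _ _) (by linarith)
  have hmL : min (max ⟪q.2.2 - q.2.1, q.1⟫_ℝ 0) (2 * L) ≤ 2 * L := min_le_right _ _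
  have hc : |clip1 (q.1 k) * clip1 (q.1 l)| ≤ 1 := by
    rw [abs_mul]
    calc |clip1 (q.1 k)| * |clip1 (q.1 l)| ≤ 1 * 1 :=
          mul_le_mul (abs_clip1_le _) (abs_clip1_le _) (abs_nonneg _) zero_le_one
      _ = 1 := one_mul 1
  have hψ := speedCutoff_mem_Icc L ‖q.2.2 - q.2.1‖
  have hψ' : |speedCutoff L ‖q.2.2 - q.2.1‖| ≤ 1 := by
    rw [abs_of_nonneg hψ.1]; exact hψ.2
  rw [abs_mul, abs_mul, abs_of_nonneg hm0]
  calc min (max ⟪q.2.2 - q.2.1, q.1⟫_ℝ 0) (2 * L) * |clip1 (q.1 k) * clip1 (q.1 l)| *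
        |speedCutoff L ‖q.2.2 - q.2.1‖|
      ≤ 2 * L * 1 * 1 := by
        refine mul_le_mul (mul_le_mul hmL hc (abs_nonneg _) (by linarith)) hψ' (abs_nonneg _) ?_
        positivity
    _ = 2 * L := by ring

/-- **The truncated mark has a bound witness** in the form consumed by `abs_tubeStat_le` /
`Theorems.stub_tubeStatRegular` (`0 ≤ L`). [folklore] -/
theorem exists_abs_evenMarkTrunc_le (k l : Fin 3) {L : ℝ} (hL : 0 ≤ L) :
    ∃ C : ℝ, ∀ q, |evenMarkTrunc k l L q| ≤ C :=
  ⟨2 * L, abs_evenMarkTrunc_le k l hL⟩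

/-- **Support of the truncated mark**: `Ξ_L = 0` whenever `2L ≤ ‖w − v‖` (`0 < L`). [folklore] -/
theorem evenMarkTrunc_eq_zero_of_le (k l : Fin 3) {L : ℝ} (hL : 0 < L) {q : V3 × V3 × V3}
    (h : 2 * L ≤ ‖q.2.2 - q.2.1‖) : evenMarkTrunc k l L q = 0 := by
  unfold evenMarkTrunc
  rw [speedCutoff_eq_zero hL h, mul_zero]

/-- **The truncation is invisible at unit normal and relative speed `≤ L`**:
`Ξ_L^{kl}(n, v, w) = Ξ_P^{kl}(n, v, w)` when `‖n‖ = 1` and `‖w − v‖ ≤ L` (`0 < L`) — at every genuine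
collision (`n = ε⁻¹ sepVec`, norm `1`) and every tube pair (predicted normal of norm `1`) of relative
speed `≤ L`. [folklore] -/
theorem evenMarkTrunc_eq_evenMark (k l : Fin 3) {L : ℝ} (hL : 0 < L) {q : V3 × V3 × V3}
    (hn : ‖q.1‖ = 1) (hs : ‖q.2.2 - q.2.1‖ ≤ L) : evenMarkTrunc k l L q = evenMark k l q := by
  unfold evenMarkTrunc evenMark
  have ha : max ⟪q.2.2 - q.2.1, q.1⟫_ℝ 0 ≤ 2 * L := by
    refine max_le ?_ (by linarith)
    calc ⟪q.2.2 - q.2.1, q.1⟫_ℝ ≤ ‖q.2.2 - q.2.1‖ * ‖q.1‖ := real_inner_le_norm _ _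
      _ = ‖q.2.2 - q.2.1‖ := by rw [hn, mul_one]
      _ ≤ 2 * L := by linarith
  have hk : |q.1 k| ≤ 1 := by
    have := PiLp.norm_apply_le q.1 k
    rw [hn, Real.norm_eq_abs] at this
    exact this
  have hl : |q.1 l| ≤ 1 := by
    have := PiLp.norm_apply_le q.1 l
    rw [hn, Real.norm_eq_abs] at this
    exact this
  rw [min_eq_left ha, clip1_eq_self hk, clip1_eq_self hl, speedCutoff_eq_one hL hs, mul_one]

/-- **The even mark is bounded by the relative speed at unit normal**: `|Ξ_P^{kl}(n, v, w)| ≤ ‖w − v‖`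
when `‖n‖ = 1` (`((w−v)·n)₊ ≤ ‖w−v‖`, `|n_k n_l| ≤ 1`). [folklore] -/
theorem abs_evenMark_le (k l : Fin 3) {q : V3 × V3 × V3} (hn : ‖q.1‖ = 1) :
    |evenMark k l q| ≤ ‖q.2.2 - q.2.1‖ := by
  unfold evenMark
  have hk : |q.1 k| ≤ 1 := by
    have := PiLp.norm_apply_le q.1 k
    rw [hn, Real.norm_eq_abs] at this
    exact this
  have hl : |q.1 l| ≤ 1 := by
    have := PiLp.norm_apply_le q.1 l
    rw [hn, Real.norm_eq_abs] at this
    exact this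
  have h0 : 0 ≤ max ⟪q.2.2 - q.2.1, q.1⟫_ℝ 0 := le_max_right _ _
  have h1 : max ⟪q.2.2 - q.2.1, q.1⟫_ℝ 0 ≤ ‖q.2.2 - q.2.1‖ := by
    refine max_le ?_ (norm_nonneg _)
    calc ⟪q.2.2 - q.2.1, q.1⟫_ℝ ≤ ‖q.2.2 - q.2.1‖ * ‖q.1‖ := real_inner_le_norm _ _
      _ = ‖q.2.2 - q.2.1‖ := by rw [hn, mul_one]
  rw [abs_mul, abs_of_nonneg h0, abs_mul]
  calc max ⟪q.2.2 - q.2.1, q.1⟫_ℝ 0 * (|q.1 k| * |q.1 l|) ≤ ‖q.2.2 - q.2.1‖ * (1 * 1) :=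
        mul_le_mul h1 (mul_le_mul hk hl (abs_nonneg _) zero_le_one) (by positivity) (norm_nonneg _)
    _ = ‖q.2.2 - q.2.1‖ := by ring

end Literature.MathematicalPhysics.KineticTheory

end
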